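import Mathlib.Data.Finset.Sups
import Mathlib.LinearAlgebra.Matrix.Determinant.Basic
import Mathlib.Order.UpperLower.Basic

/-!
# `NoHeavyLowerTail` (crux stmt-CriticalPhenomena-4575), lane prim-ineq-gen-4 (gen 21): the anti-band inequality (AB_l) from a covering bijection,
# and a covering bijection from a non-vanishing determinant (the "determinant criterion")

Support file (`--supports stmt-CriticalPhenomena-4575`; memo `run/shared/lean/prim/prim-ineq-gen-4/FINDING-DET-CRITERION-g21.md` §1).
Pure finite combinatorics / linear algebra, no definitions, no `sorry`, standard axioms.

(AB_l) for families `W, V` of finsets of `β` (with `V` an upper set) asks `#{s ∈ W ∩ Vᶜˢ | outer s} ≤ #{s ∈ W ∩ V | outer s}` with `outer s :↔ #s < l ∨ #sᶜ < l`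
(gen 19/20 files `…AntiBandJ`, `…AntiBandShift`, `…AntiBandDegenerate`).  Gen 21 observes:

* `antiBand_of_covering_map` : if some map `Φ` sends the outer part `W' = {s ∈ W | outer s}` injectively into itself with `sᶜ ⊆ Φ s`, then (AB_l) holds for `W`
  and EVERY upper set `V` (the map `s ↦ Φ s` injects the counted members of `W ∩ Vᶜˢ` into those of `W ∩ V`);
* `exists_covering_perm_of_det_ne_zero` : if the *covering matrix* `C[s,t] = [s ∪ t = univ]` of a finite indexed family has non-zero determinant (over `ℤ`), some
  permutation `σ` of the index type has `s (σ i) ∪ s i = univ` for all `i` (a non-zero Leibniz term);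
* `antiBand_of_det_ne_zero` : hence `det C ≠ 0` for the outer part of `W` implies (AB_l) for `W` and every upper set `V`.

The memo shows `|det C| = |det [C(y−1−#(x ∪ x'), l−1)]_{x,x' ∈ W, #x < l}|` when `W` is an upper set (Schur complement over a unimodular disjointness matrix), which turns
(AB_l)(y) into the non-singularity of one explicit binomial matrix per left-shifted up-closed family of small sets; that identity is not formalised here.
-/

namespace Summit.CriticalPhenomena.PercolationContinuityZ3.Theorems.AntiBandMatching

open Finset
open scoped FinsetFamily

variable {β : Type*} [DecidableEq β] [Fintype β]

/-- **(AB_l) from a covering map.**  Let `W' = {s ∈ W | #s < l ∨ #sᶜ < l}`.  If `Φ` maps `W'` injectively into `W'` with `sᶜ ⊆ Φ s` for all `s ∈ W'`, then for every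
upper set `V`: `#{s ∈ W ∩ Vᶜˢ | outer} ≤ #{s ∈ W ∩ V | outer}` — the counted `s` with `sᶜ ∈ V` are sent injectively to counted members of `V` (as `sᶜ ⊆ Φ s` and `V` is
an upper set). [gen 21, FINDING-DET-CRITERION-g21.md §1(i)] -/
theorem antiBand_of_covering_map (l : ℕ) (W V : Finset (Finset β)) (hV : IsUpperSet (V : Set (Finset β)))
    (Φ : Finset β → Finset β)
    (hΦ : ∀ s ∈ W.filter (fun s => #s < l ∨ #sᶜ < l), Φ s ∈ W.filter (fun s => #s < l ∨ #sᶜ < l))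
    (hcov : ∀ s ∈ W.filter (fun s => #s < l ∨ #sᶜ < l), sᶜ ⊆ Φ s)
    (hinj : Set.InjOn Φ ↑(W.filter (fun s => #s < l ∨ #sᶜ < l))) :
    #((W ∩ Vᶜˢ).filter fun s => #s < l ∨ #sᶜ < l) ≤ #((W ∩ V).filter fun s => #s < l ∨ #sᶜ < l) := by
  classical
  apply Finset.card_le_card_of_injOn Φ
  · intro s hs
    rw [mem_coe, mem_filter, mem_inter, mem_compls] at hs
    obtain ⟨⟨hsW, hscV⟩, hso⟩ := hs
    have hs' : s ∈ W.filter (fun s => #s < l ∨ #sᶜ < l) := mem_filter.2 ⟨hsW, hso⟩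
    have h1 := hΦ s hs'
    rw [mem_filter] at h1
    rw [mem_coe, mem_filter, mem_inter]
    exact ⟨⟨h1.1, hV (hcov s hs') hscV⟩, h1.2⟩
  · intro s hs t ht hst
    rw [mem_coe, mem_filter, mem_inter] at hs ht
    exact hinj (mem_coe.2 (mem_filter.2 ⟨hs.1.1, hs.2⟩)) (mem_coe.2 (mem_filter.2 ⟨ht.1.1, ht.2⟩)) hst

/-- **A covering permutation from a non-zero determinant.**  For a finite indexed family `s : ι → Finset β`, if the covering matrix
`C i j = [s i ∪ s j = univ]` (entries `0/1` in `ℤ`) has `det C ≠ 0`, then some permutation `σ` satisfies `s (σ i) ∪ s i = univ` for every `i`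
(Leibniz expansion: a non-zero determinant has a non-zero permutation term). [gen 21, §1(ii)] -/
theorem exists_covering_perm_of_det_ne_zero {ι : Type*} [Fintype ι] [DecidableEq ι] (s : ι → Finset β)
    (hdet : (Matrix.of fun i j : ι => if s i ∪ s j = univ then (1 : ℤ) else 0).det ≠ 0) :
    ∃ σ : Equiv.Perm ι, ∀ i, s (σ i) ∪ s i = univ := by
  classical
  by_contra hno
  push Not at hno
  apply hdet
  rw [Matrix.det_apply]
  apply Finset.sum_eq_zero
  intro σ _
  obtain ⟨i, hi⟩ := hno σ
  have hzero : (∏ j, (Matrix.of fun i j : ι => if s i ∪ s j = univ then (1 : ℤ) else 0) (σ j) j) = 0 := by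
    apply Finset.prod_eq_zero (Finset.mem_univ i)
    simp only [Matrix.of_apply, if_neg hi]
  rw [hzero, smul_zero]

/-- **Determinant criterion for (AB_l).**  Let `W' = {s ∈ W | #s < l ∨ #sᶜ < l}` (as a subtype) and `C` its covering matrix `C s t = [s ∪ t = univ]` over `ℤ`.
If `det C ≠ 0` then (AB_l) holds for `W` and every upper set `V`.  (By the memo, for an upper set `W` in `2^[y]` with `y ≥ 2l` one has
`|det C| = |det [Nat.choose (y−1−#(x∪x')) (l−1)]_{x,x' ∈ W, #x<l}|`.) [gen 21, §1] -/
theorem antiBand_of_det_ne_zero (l : ℕ) (W V : Finset (Finset β)) (hV : IsUpperSet (V : Set (Finset β)))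
    (hdet : (Matrix.of fun i j : ↥(W.filter fun s => #s < l ∨ #sᶜ < l) =>
      if (i : Finset β) ∪ (j : Finset β) = univ then (1 : ℤ) else 0).det ≠ 0) :
    #((W ∩ Vᶜˢ).filter fun s => #s < l ∨ #sᶜ < l) ≤ #((W ∩ V).filter fun s => #s < l ∨ #sᶜ < l) := by
  classical
  set W' := W.filter (fun s => #s < l ∨ #sᶜ < l) with hW'
  obtain ⟨σ, hσ⟩ := exists_covering_perm_of_det_ne_zero (fun i : ↥W' => (i : Finset β)) hdet
  -- the covering map: `Φ s = σ ⟨s, _⟩` on `W'`, identity elsewhere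
  let Φ : Finset β → Finset β := fun s => if h : s ∈ W' then (σ ⟨s, h⟩ : Finset β) else s
  have hΦeq : ∀ (s : Finset β) (h : s ∈ W'), Φ s = (σ ⟨s, h⟩ : Finset β) := fun s h => by
    simp only [Φ, dif_pos h]
  refine antiBand_of_covering_map l W V hV Φ ?_ ?_ ?_
  · intro s hs
    rw [hΦeq s hs]
    exact (σ ⟨s, hs⟩).2
  · intro s hs
    rw [hΦeq s hs]
    have h := hσ ⟨s, hs⟩
    -- `σ s ∪ s = univ` gives `sᶜ ⊆ σ s`
    intro a ha
    have hau : a ∈ (σ ⟨s, hs⟩ : Finset β) ∪ s := by rw [h]; exact mem_univ a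
    rcases mem_union.1 hau with h1 | h2
    · exact h1
    · exact absurd h2 (mem_compl.1 ha)
  · intro s hs t ht hst
    have hs' : s ∈ W' := hs
    have ht' : t ∈ W' := ht
    rw [hΦeq s hs', hΦeq t ht'] at hst
    have : (⟨s, hs'⟩ : ↥W') = ⟨t, ht'⟩ := σ.injective (Subtype.ext hst)
    exact congrArg Subtype.val this

end Summit.CriticalPhenomena.PercolationContinuityZ3.Theorems.AntiBandMatching
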